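import Summits.RiemannHypothesis.RiemannHypothesis.Theses.EvenSectorBarta
import Summits.RiemannHypothesis.RiemannHypothesis.Theorems.GroundBartaPolarPerronFrobeniusEvenSectorDeciding
import HarnessLib

/-!
# Route `EvenSectorBarta`, item `EvenBartaFloor` (stmt-RiemannHypothesis-19954) — closed

For every window `a > 0` carrying an even-sector bottom state that is real and `≥ 0` a.e. on
`(-a, a)`, every even `L²`-normalised smooth test `h` supported in `[-a, a]` has `-e(a) ≤ Re Q h`
with the EXPLICIT Barta rate `e(a) = 2(∫_{s>a} Φ(s)·2cosh(s/2) ds)·cosh(a/2)/Φ(a)`.  This is the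
EVEN-SECTOR BARTA FLOOR of route GroundBarta
(`PolarPerronFrobenius.neg_groundBartaRate_le_weilEvenGroundEnergy`,
Theorems/GroundBartaPolarPerronFrobeniusEvenFloor.lean: harmonic splitting of the outer cut-offs of
Riemann's kernel, leakage limit along the even minimising sequence, leakage sign, Cauchy–Schwarz in
the even sector at the larger window and continuity of `ε_ev`), in the token-for-token route form
`PolarPerronFrobenius.evenBartaFloor_routeForm`.  RH-free.
References: Bombieri 2000 §4 Lemma 1; Barta 1937 via López-Gómez doi:10.1142/8664 p.175.
-/

set_option linter.dupNamespace false

namespace Summit.RiemannHypothesis.RiemannHypothesis.Theorems.EvenSectorBarta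

/-- **Item `EvenBartaFloor` (stmt-RiemannHypothesis-19954)**: the explicit even theta-vector Barta
floor at every window carrying a one-signed even-sector bottom state. [cite: Bombieri2000Weil, §4 Lemma 1] -/
theorem evenBartaFloor_proof :
    Summit.RiemannHypothesis.RiemannHypothesis.Theses.EvenSectorBarta.EvenBartaFloor :=
  Summit.RiemannHypothesis.RiemannHypothesis.Theorems.PolarPerronFrobenius.evenBartaFloor_routeForm

end Summit.RiemannHypothesis.RiemannHypothesis.Theorems.EvenSectorBarta
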